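import Mathlib.Geometry.Manifold.Instances.Sphere
import Mathlib.Geometry.Manifold.Instances.Real
import Mathlib.Geometry.Manifold.IsManifold.InteriorBoundary
import Literature.Topology.FourManifolds.Gluing
import Literature.Topology.FourManifolds.Cobordism
import HarnessLib

-- provenance: harness21/H21/H21/Prelude/FourManL/ClosedBall.lean @ 08a4208 (interim HEAD d8f2665); M5 mechanical rewrite
/-!
# The closed ball `𝔻ⁿ⁺¹` as a manifold with boundary (trunk T-4MAN, prelude `FourManL`)

Notions `gluing_along_boundary` / `manifold_boundary_as_manifold` of the G24 outline
(`H21/Outlines/FourManL.md`, §C2): the *model example* of a compact smooth manifold with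
boundary, the closed unit ball `𝔻ⁿ⁺¹ = Metric.closedBall (0 : ℝⁿ⁺¹) 1`, deferred by G18
(`Outlines/FourManM.md`, §4.7), together with its boundary datum `∂𝔻ⁿ⁺¹ = 𝕊ⁿ`
(`Literature.Topology.FourManifolds.BoundaryData` of `Literature.Prelude.FourManM.Cobordism`), the statement that `𝕊ⁿ⁺¹` is its
double (`Literature.Topology.FourManifolds.IsDouble` of `Literature.Prelude.FourManL.Gluing`) and an explicit radial collar
(`Literature.Topology.FourManifolds.BoundaryData.Collar`).

## Informal content

The closed ball `𝔻ⁿ⁺¹ ⊆ ℝⁿ⁺¹` is a compact smooth `(n+1)`-manifold with boundary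
`∂𝔻ⁿ⁺¹ = 𝕊ⁿ` and interior the open ball (Lee, *Introduction to Smooth Manifolds* (2013), Ch. 1,
"Manifolds with boundary" and Problem 1-11; also Prop. 5.47: regular sublevel sets such as
`{x | ‖x‖² ≤ 1}` are regular domains; Hirsch, *Differential Topology* (1976), §1.4). An atlas
valued in the half-space `ℍⁿ⁺¹ = {y ∈ ℝⁿ⁺¹ | 0 ≤ y 0}` (Mathlib's `EuclideanHalfSpace (n + 1)`,
model with corners `𝓡∂ (n + 1)`):
* the *interior chart* `x ↦ x + 2 e₀` on the open ball `{‖x‖ < 1}` (a translate of the open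
  ball inside the open half-space);
* for each `p ∈ 𝕊ⁿ` the *boundary chart* ("polar coordinates")
  `x ↦ (1 - ‖x‖, σ_p (x / ‖x‖))` on `{x ≠ 0, x / ‖x‖ ≠ -p}`, where `σ_p` is the stereographic
  chart of `𝕊ⁿ` from the pole `-p` (Mathlib's `stereographic' n (-p) = chartAt (𝔼 n) p`); its
  first coordinate vanishes exactly on `𝕊ⁿ`.
The sphere `𝕊ⁿ⁺¹` is the double `𝔻ⁿ⁺¹ ∪_{id} 𝔻ⁿ⁺¹` (two hemispheres; Hirsch (1976), §8.2;
Bröcker–Jänich (1982), §13), and `(x, t) ↦ (1 - t/2) x` is a collar of `∂𝔻ⁿ⁺¹` (Hirsch (1976),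
§4.6) for `n ≥ 1` (for `𝔻¹` see "Design choices": with Mathlib's immersions the corner points
of `𝕊⁰ × [0, 1]` obstruct, and the collar statements are made for `𝔻ⁿ⁺²`).

## Mathlib

Mathlib has `Metric.closedBall`, its compactness as a subtype (`ProperSpace` instance
`CompactSpace ↥(closedBall x r)`, `Topology/MetricSpace/ProperSpace.lean`), the half-space model
`EuclideanHalfSpace`, `𝓡∂ n`, the one-dimensional analogue `instIccChartedSpace` /
`instIsManifoldIcc` and `boundary_Icc` (`Geometry/Manifold/Instances/Real.lean`), the sets
`ModelWithCorners.boundary/interior` (`IsManifold/InteriorBoundary.lean`), and the analytic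
manifold `𝕊ⁿ` with charts `stereographic'` (`Instances/Sphere.lean`; we reuse them inside the
boundary charts, under the local `Fact (finrank ℝ ℝⁿ⁺¹ = n + 1)` instance Mathlib itself uses
inline). Mathlib has no charted-space structure on a closed ball of dimension `> 1`
(`rg closedBall Mathlib/Geometry/Manifold` finds only bump-function lemmas): the charts, the
`ChartedSpace` instance and everything below are new.

## Design choices

* Charts are honest `OpenPartialHomeomorph`s with all fields proved (sources, targets,
  inverses, continuity). Total inverse maps use the radial retraction `closedBallRetraction`
  (`y ↦ y / max ‖y‖ 1`) and the clamp `min (z 0) 1`; the radial projection `radialProjection`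
  has junk value `p` at the origin (never used there).
* `instChartedSpaceClosedBall`: atlas `{interior chart} ∪ {boundary chart at p | p ∈ 𝕊ⁿ}`,
  `chartAt x` = interior chart if `‖x‖ < 1`, boundary chart at `x` itself if `‖x‖ = 1`.
* `instIsManifoldClosedBall : IsManifold (𝓡∂ (n + 1)) ∞ 𝔻ⁿ⁺¹` is proved for real (no
  fallback needed): via `isManifold_of_contDiffOn`, the four kinds of transition maps are
  identified on the relevant half-space regions with explicit maps `ℝⁿ⁺¹ → ℝⁿ⁺¹` built from
  translations, `x ↦ ‖x‖` off `0` (`ContDiffAt.norm`), and Mathlib's analytic `stereoToFun` /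
  `stereoInvFunAux` (`contDiffOn_closedBall_transition_*`, reduction lemma
  `contDiffOn_transition_of`).
* `boundary_closedBall : ∂𝔻ⁿ⁺¹ = {‖x‖ = 1}` and `interior_closedBall` are proved for real from
  the explicit charts, as is `range_inclusion_eq_boundary`; `isSmoothEmbedding_sphereInclusion'`
  (immersion property of `𝕊ⁿ ↪ 𝔻ⁿ⁺¹`), `isDouble_sphere` and
  `isSmoothEmbedding_closedBallCollarMap` are named facts (`def … : Prop`); the first is
  discharged at the end of the file (`isSmoothEmbedding_sphereInclusion'_holds`, real proof: in
  the charts `stereographic' n (-x)` / `closedBallBoundaryChart x` the inclusion reads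
  `w ↦ (0, w)`; registered as the instance `fact_isSmoothEmbedding_sphereInclusion'`), the other
  two are unproved here.
  `closedBallBoundaryData` and `closedBallCollar` are real definitions whose proof fields take
  those facts as hypotheses: the instance argument `[Fact (isSmoothEmbedding_sphereInclusion' n)]`
  for the boundary datum, an explicit `(h : isSmoothEmbedding_closedBallCollarMap n)` for the
  collar.
* **Collar only in ball dimension `≥ 2`.** The radial collar map `closedBallCollarMap n` and its
  elementary API are stated for all `n`, but `isSmoothEmbedding_closedBallCollarMap`,
  `closedBallCollar` and `nonempty_collar_closedBallBoundaryData` are stated for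
  `closedBallBoundaryData (n + 1)` (ball `𝔻ⁿ⁺²`): for `𝔻¹` the source `𝕊⁰ × [0, 1]` has model
  `(𝓡 0).prod (𝓡∂ 1)` whose model boundary is the single point `0`, and Mathlib's (linear)
  immersion property `Manifold.ImmersionAtProp` at the corner `(x, ⊤)` would force the interior
  point `(1/2) • x ∈ 𝔻¹` to be a chart-boundary point — impossible by invariance of the boundary.
  The obstruction is recorded as the named fact (invariance of boundary is not in Mathlib)
  `isEmpty_collar_closedBallBoundaryData_zero`. **Cross-file note:** by the same argument the
  accepted general theorem `Literature.Topology.FourManifolds.BoundaryData.nonempty_collar` (`Literature.Prelude.FourManL.Gluing`) is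
  false for `n = 0` with nonempty carrier (e.g. `b = closedBallBoundaryData 0`) and needs
  `n ≠ 0` (or a shift `n + 1`); flagged to the architect as a follow-up revision of `Gluing`.
* **Sphere instances.** Mathlib states the `ChartedSpace`/`IsManifold` instances of `𝕊ⁿ`
  (`Instances/Sphere.lean`) under `[Fact (finrank ℝ E = n + 1)]`, supplied inline there; this
  file registers `fact_finrank_euclideanSpace_succ` as a *local* instance. The instance-valued
  fields of `closedBallBoundaryData` are therefore filled with the sphere instances found under
  this local `Fact`; consumers without it get Mathlib's global instances
  (`EuclideanSpace.instChartedSpaceSphere`, `EuclideanSpace.instIsManifoldSphere`), which are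
  definitionally equal (same reducible construction, proof-irrelevant `Fact` argument), so
  unification succeeds — if it is ever slow, add
  `attribute [local instance] Literature.fact_finrank_euclideanSpace_succ`.
* Implicitness: in `radialProjection p`, `closedBallBoundaryChart p` and the lemmas about
  `closedBallCollarMap n q` the dimension `n` is implicit (determined by `p`/`q`); it is
  explicit in `closedBallInteriorChart n`, `closedBallCollarMap n`, `closedBallBoundaryData n`.
* Names: the prime in `isSmoothEmbedding_sphereInclusion'` avoids G18's
  `Literature.Topology.FourManifolds.isSmoothEmbedding_sphereInclusion` (equatorial inclusions `𝕊ᵏ ↪ 𝕊ⁿ`, `Knots.lean`).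

Manifold conventions and the local notations `𝔼 n`, `𝕊 n` are those of the accepted G18 files;
`𝔻 n` abbreviates `Metric.closedBall (0 : 𝔼 n) 1`.
-/

open scoped Manifold ContDiff Topology
open Set Function Metric WithLp

noncomputable section

namespace Literature.Topology.FourManifolds

/-- Local notation: `𝔼 n` is the model Euclidean space `EuclideanSpace ℝ (Fin n)`. -/
local notation "𝔼 " n:arg => EuclideanSpace ℝ (Fin n)

/-- Local notation: `𝕊 n` is the unit sphere in `EuclideanSpace ℝ (Fin (n + 1))` (a `Set`,
used as a type through the coercion). -/
local notation "𝕊 " n:arg => (Metric.sphere (0 : EuclideanSpace ℝ (Fin (n + 1))) 1)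

/-- Local notation: `𝔻 n` is the closed unit ball in `EuclideanSpace ℝ (Fin n)` (a `Set`, used
as a type through the coercion). -/
local notation "𝔻 " n:arg => (Metric.closedBall (0 : EuclideanSpace ℝ (Fin n)) 1)

/-- `dim_ℝ ℝⁿ⁺¹ = n + 1` as a `Fact` (Mathlib `finrank_euclideanSpace_fin`), the typeclass
assumption under which Mathlib's stereographic charts `stereographic' n` of `𝕊ⁿ` are stated;
Mathlib registers it only inline (`Geometry/Manifold/Instances/Sphere.lean`), so we make it a
*local* instance in this file (all resulting instances agree with Mathlib's by proof
irrelevance). [folklore] -/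
theorem fact_finrank_euclideanSpace_succ (n : ℕ) : Fact (Module.finrank ℝ (𝔼 (n + 1)) = n + 1) :=
  ⟨finrank_euclideanSpace_fin⟩

attribute [local instance] fact_finrank_euclideanSpace_succ

variable (n : ℕ)

/-! ### Auxiliary maps: radial retraction and radial projection -/

/-- The radial retraction of `ℝⁿ` onto the closed unit ball, `y ↦ y / max ‖y‖ 1`: the identity
on `𝔻ⁿ` and `y ↦ y / ‖y‖` outside. Used as the (total) inverse of the interior chart of the
closed ball. Standard (e.g. Hirsch, *Differential Topology* (1976), §1.4). [folklore] -/
def closedBallRetraction (y : 𝔼 n) : 𝔻 n :=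
  ⟨(max ‖y‖ 1)⁻¹ • y, by
    have h : 0 < max ‖y‖ 1 := lt_max_of_lt_right one_pos
    rw [mem_closedBall_zero_iff, norm_smul, norm_inv, Real.norm_of_nonneg h.le,
      inv_mul_le_iff₀ h, mul_one]
    exact le_max_left _ _⟩

/-- The radial retraction is continuous. [folklore] -/
theorem continuous_closedBallRetraction : Continuous (closedBallRetraction n) := by
  refine Continuous.subtype_mk (?_ : Continuous fun y : 𝔼 n => (max ‖y‖ 1)⁻¹ • y) _
  exact ((continuous_norm.max continuous_const).inv₀ fun y =>
    (lt_max_of_lt_right one_pos).ne').smul continuous_id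

/-- On the closed unit ball the radial retraction is the identity. [folklore] -/
theorem closedBallRetraction_of_norm_le {y : 𝔼 n} (hy : ‖y‖ ≤ 1) :
    (closedBallRetraction n y : 𝔼 n) = y := by
  simp [closedBallRetraction, max_eq_right hy]

/-- The radial projection `x ↦ x / ‖x‖` of `ℝⁿ⁺¹` onto the unit sphere `𝕊ⁿ`, with junk value `p`
at the origin (where it is used only off the origin); the dimension `n` is implicit (determined
by `p`). Standard (Hirsch, *Differential Topology* (1976), §1.4). Mathlib has no such named
function (`rg 'norm.*⁻¹ • ' Mathlib/Analysis/InnerProductSpace` yields only inline uses). [folklore] -/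
def radialProjection {n : ℕ} (p : 𝕊 n) (x : 𝔼 (n + 1)) : 𝕊 n :=
  if hx : x = 0 then p else ⟨‖x‖⁻¹ • x, by simp [norm_smul, hx]⟩

variable {n}

/-- Off the origin the radial projection is `x ↦ ‖x‖⁻¹ • x`. [folklore] -/
theorem coe_radialProjection_of_ne_zero (p : 𝕊 n) {x : 𝔼 (n + 1)} (hx : x ≠ 0) :
    (radialProjection p x : 𝔼 (n + 1)) = ‖x‖⁻¹ • x := by
  simp [radialProjection, hx]

/-- A nonnegative multiple `t • s` of a unit vector has norm `t`. [folklore] -/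
theorem norm_smul_coe_sphere {t : ℝ} (ht : 0 ≤ t) (s : 𝕊 n) : ‖t • (s : 𝔼 (n + 1))‖ = t := by
  rw [norm_smul, norm_eq_of_mem_sphere, mul_one, Real.norm_of_nonneg ht]

/-- The radial projection of a positive multiple `t • s` of a unit vector `s` is `s`. [folklore] -/
theorem radialProjection_smul (p : 𝕊 n) {t : ℝ} (ht : 0 < t) (s : 𝕊 n) :
    radialProjection p (t • (s : 𝔼 (n + 1))) = s := by
  have h : t • (s : 𝔼 (n + 1)) ≠ 0 := smul_ne_zero ht.ne' (ne_zero_of_mem_unit_sphere s)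
  ext1
  rw [coe_radialProjection_of_ne_zero p h, norm_smul_coe_sphere ht.le, smul_smul,
    inv_mul_cancel₀ ht.ne', one_smul]

/-- `‖x‖ • (x / ‖x‖) = x` (also at the origin, thanks to the junk value). [folklore] -/
theorem norm_smul_coe_radialProjection (p : 𝕊 n) (x : 𝔼 (n + 1)) :
    ‖x‖ • (radialProjection p x : 𝔼 (n + 1)) = x := by
  by_cases hx : x = 0
  · simp [hx]
  · rw [coe_radialProjection_of_ne_zero p hx, smul_smul, mul_inv_cancel₀ (norm_ne_zero_iff.2 hx),
      one_smul]

/-- The radial projection is continuous off the origin. [folklore] -/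
theorem continuousOn_radialProjection (p : 𝕊 n) :
    ContinuousOn (radialProjection p) {x | x ≠ 0} := by
  rw [Topology.IsInducing.subtypeVal.continuousOn_iff]
  refine ContinuousOn.congr (f := fun x : 𝔼 (n + 1) => ‖x‖⁻¹ • x) ?_ fun x hx => ?_
  · exact ((continuous_norm.continuousOn).inv₀ fun x hx => norm_ne_zero_iff.2 hx).smul
      continuousOn_id
  · exact coe_radialProjection_of_ne_zero p hx

/-- Every coordinate of a point of the closed unit ball is at least `-1`. [folklore] -/
theorem neg_one_le_coe_closedBall_apply {n : ℕ} (x : 𝔻 (n + 1)) (i : Fin (n + 1)) :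
    -1 ≤ (x : 𝔼 (n + 1)) i :=
  (abs_le.1 (((x : 𝔼 (n + 1)).norm_apply_le i).trans (mem_closedBall_zero_iff.1 x.2))).1

variable (n)

/-! ### The two kinds of charts -/

/-- The base vector `e₀ = (1, 0, …, 0)` of `ℝⁿ⁺¹`, normal to the boundary hyperplane of the
half-space `EuclideanHalfSpace (n + 1) = {x | 0 ≤ x 0}`. (Not to be confused with G18's
`Literature.framingBaseVector = (1/2) • e₀` of `Literature.Prelude.FourManM.Framing`, the base point of the
standard tubular neighbourhoods of knots.) [folklore] -/
abbrev closedBallBaseVector : 𝔼 (n + 1) := EuclideanSpace.single 0 1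

/-- For `x` in the closed unit ball, the `0`-th coordinate of `x + 2 • e₀` is nonnegative (in
fact `≥ 1`). [folklore] -/
theorem one_le_coe_add_two_smul_apply (x : 𝔻 (n + 1)) :
    1 ≤ ((x : 𝔼 (n + 1)) + (2 : ℝ) • closedBallBaseVector n) 0 := by
  have := neg_one_le_coe_closedBall_apply x 0
  simp only [PiLp.add_apply, PiLp.smul_apply, PiLp.single_apply, if_true, smul_eq_mul, mul_one]
  linarith

/-- **Interior chart of the closed ball.** The chart of `𝔻ⁿ⁺¹ = closedBall 0 1 ⊆ ℝⁿ⁺¹` with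
source the open ball `{x | ‖x‖ < 1}`, given by the translation `x ↦ x + 2 • e₀` into the open
half-space `{y | 0 < y 0} ⊆ EuclideanHalfSpace (n + 1)`; its target is the open ball of radius
`1` around `2 • e₀`. Lee, *Introduction to Smooth Manifolds* (2013), Ch. 1 ("Manifolds with
boundary": interior charts; Problem 1-11: the closed ball `𝔹̄ⁿ` is a smooth manifold with
boundary); Hirsch, *Differential Topology* (1976), §1.4. [folklore] -/
def closedBallInteriorChart : OpenPartialHomeomorph (𝔻 (n + 1)) (EuclideanHalfSpace (n + 1)) where
  source := {x | ‖(x : 𝔼 (n + 1))‖ < 1}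
  target := {z | ‖z.val - (2 : ℝ) • closedBallBaseVector n‖ < 1}
  toFun x := ⟨(x : 𝔼 (n + 1)) + (2 : ℝ) • closedBallBaseVector n,
    zero_le_one.trans (one_le_coe_add_two_smul_apply n x)⟩
  invFun z := closedBallRetraction (n + 1) (z.val - (2 : ℝ) • closedBallBaseVector n)
  map_source' x hx := by simpa using hx
  map_target' z hz := by
    simp only [mem_setOf_eq] at hz ⊢
    rwa [closedBallRetraction_of_norm_le (n + 1) hz.le]
  left_inv' x hx := by
    ext1
    simp only [add_sub_cancel_right]
    exact closedBallRetraction_of_norm_le (n + 1) (le_of_lt hx)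
  right_inv' z hz := by
    apply Subtype.ext
    simp only [mem_setOf_eq] at hz
    simp only [closedBallRetraction_of_norm_le (n + 1) hz.le, sub_add_cancel]
  open_source := isOpen_Iio.preimage (continuous_subtype_val.norm)
  open_target := isOpen_Iio.preimage ((continuous_subtype_val.sub continuous_const).norm)
  continuousOn_toFun := ((continuous_subtype_val.add continuous_const).subtype_mk _).continuousOn
  continuousOn_invFun :=
    ((continuous_closedBallRetraction (n + 1)).comp
      (continuous_subtype_val.sub continuous_const)).continuousOn

variable {n} in
/-- If `x ≠ 0` and `x / ‖x‖ ≠ -p` then the radial projection of `x` lies in the source `{-p}ᶜ`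
of the stereographic chart `stereographic' n (-p)` of `𝕊ⁿ` (Mathlib's `chartAt (𝔼 n) p`). [folklore] -/
theorem radialProjection_mem_source_stereographic' {p : 𝕊 n} {x : 𝔼 (n + 1)} (hx : x ≠ 0)
    (hxp : ‖x‖⁻¹ • x ≠ -(p : 𝔼 (n + 1))) :
    radialProjection p x ∈ (stereographic' n (-p)).source := by
  rw [stereographic'_source, mem_compl_singleton_iff]
  intro h
  apply hxp
  rw [← coe_radialProjection_of_ne_zero p hx, h, coe_neg_sphere]

/-- **Boundary chart of the closed ball** at the boundary point `p : 𝕊ⁿ`. Its source is the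
set of `x ∈ 𝔻ⁿ⁺¹` with `x ≠ 0` and `x / ‖x‖ ≠ -p`, and it sends `x` to
`(1 - ‖x‖, σ (x / ‖x‖)) ∈ EuclideanHalfSpace (n + 1)` where `σ = stereographic' n (-p)` is
Mathlib's stereographic chart of `𝕊ⁿ` from the pole `-p` (i.e. `chartAt (𝔼 n) p`); the first
coordinate `1 - ‖x‖ ≥ 0` vanishes exactly on the boundary sphere. The target is
`{z | z 0 < 1}` and the inverse is `z ↦ (1 - z 0) • σ⁻¹ (z 1, …, z n)` ("polar coordinates").
Lee, *Introduction to Smooth Manifolds* (2013), Ch. 1 (the closed ball `𝔹̄ⁿ` is a smooth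
manifold with boundary, Problem 1-11) and Ch. 5 (Prop. 5.47: regular sublevel sets are regular
domains); Hirsch, *Differential Topology* (1976), §1.4. [folklore] -/
def closedBallBoundaryChart {n : ℕ} (p : 𝕊 n) :
    OpenPartialHomeomorph (𝔻 (n + 1)) (EuclideanHalfSpace (n + 1)) where
  source := {x | (x : 𝔼 (n + 1)) ≠ 0 ∧ ‖(x : 𝔼 (n + 1))‖⁻¹ • (x : 𝔼 (n + 1)) ≠ -(p : 𝔼 (n + 1))}
  target := {z | z.val 0 < 1}
  toFun x := ⟨toLp 2 (Fin.cons (1 - ‖(x : 𝔼 (n + 1))‖)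
      (ofLp (stereographic' n (-p) (radialProjection p x))) : Fin (n + 1) → ℝ),
    by simpa using mem_closedBall_zero_iff.1 x.2⟩
  invFun z := ⟨(1 - min (z.val 0) 1) •
      ((stereographic' n (-p)).symm (toLp 2 fun i : Fin n => z.val i.succ) : 𝔼 (n + 1)), by
    rw [mem_closedBall_zero_iff, norm_smul_coe_sphere (sub_nonneg.2 (min_le_right _ _))]
    exact sub_le_self _ (le_min z.2 zero_le_one)⟩
  map_source' x hx := by
    simp only [mem_setOf_eq, Fin.cons_zero, sub_lt_self_iff, norm_pos_iff]
    exact hx.1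
  map_target' z hz := by
    simp only [mem_setOf_eq] at hz ⊢
    set s := (stereographic' n (-p)).symm (toLp 2 fun i : Fin n => z.val i.succ)
    have ht : 0 < 1 - min (z.val 0) 1 := by rw [min_eq_left hz.le]; linarith
    have hs : s ∈ (stereographic' n (-p)).source :=
      (stereographic' n (-p)).map_target (by simp)
    rw [stereographic'_source, mem_compl_singleton_iff] at hs
    refine ⟨smul_ne_zero ht.ne' (ne_zero_of_mem_unit_sphere s), fun h => hs ?_⟩
    rw [norm_smul_coe_sphere ht.le, smul_smul, inv_mul_cancel₀ ht.ne', one_smul] at h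
    exact Subtype.ext (by simpa using h)
  left_inv' x hx := by
    obtain ⟨hx0, hxp⟩ := hx
    apply Subtype.ext
    have h1 : min (1 - ‖(x : 𝔼 (n + 1))‖) 1 = 1 - ‖(x : 𝔼 (n + 1))‖ :=
      min_eq_left (sub_le_self _ (norm_nonneg _))
    have h2 : (toLp 2 fun i : Fin n => (toLp 2 (Fin.cons (1 - ‖(x : 𝔼 (n + 1))‖)
        (ofLp (stereographic' n (-p) (radialProjection p x))) : Fin (n + 1) → ℝ)) i.succ) =
        stereographic' n (-p) (radialProjection p x) := by
      ext i
      simp only [Fin.cons_succ]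
    simp only [Fin.cons_zero, h1, sub_sub_cancel]
    rw [h2, (stereographic' n (-p)).left_inv (radialProjection_mem_source_stereographic' hx0 hxp),
      norm_smul_coe_radialProjection]
  right_inv' z hz := by
    simp only [mem_setOf_eq] at hz
    have h1 : min (z.val 0) 1 = z.val 0 := min_eq_left hz.le
    have ht : 0 < 1 - z.val 0 := by linarith
    apply Subtype.ext
    simp only [h1]
    rw [norm_smul_coe_sphere ht.le, radialProjection_smul p ht,
      (stereographic' n (-p)).right_inv (by simp), sub_sub_cancel]
    ext i
    refine Fin.cases ?_ (fun j => ?_) i <;> simp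
  open_source := by
    have hc : ContinuousOn (fun x : 𝔻 (n + 1) => ‖(x : 𝔼 (n + 1))‖⁻¹ • (x : 𝔼 (n + 1)))
        {x | (x : 𝔼 (n + 1)) ≠ 0} :=
      ((continuous_subtype_val.norm).continuousOn.inv₀ fun x hx => norm_ne_zero_iff.2 hx).smul
        continuous_subtype_val.continuousOn
    exact hc.isOpen_inter_preimage (isOpen_ne.preimage continuous_subtype_val) isOpen_ne
  open_target := by
    have : Continuous fun z : EuclideanHalfSpace (n + 1) => z.val 0 := by fun_prop
    exact isOpen_Iio.preimage this
  continuousOn_toFun := by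
    have hval : Topology.IsInducing (Subtype.val : EuclideanHalfSpace (n + 1) → 𝔼 (n + 1)) :=
      Topology.IsInducing.subtypeVal
    refine hval.continuousOn_iff.2 ?_
    have hF : Continuous fun q : ℝ × 𝔼 n => toLp 2 (Fin.cons q.1 (ofLp q.2) : Fin (n + 1) → ℝ) :=
      by fun_prop
    have hG : ContinuousOn (fun x : 𝔻 (n + 1) =>
        (1 - ‖(x : 𝔼 (n + 1))‖, stereographic' n (-p) (radialProjection p x)))
        {x | (x : 𝔼 (n + 1)) ≠ 0 ∧ ‖(x : 𝔼 (n + 1))‖⁻¹ • (x : 𝔼 (n + 1)) ≠ -(p : 𝔼 (n + 1))} := by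
      refine (continuous_const.sub continuous_subtype_val.norm).continuousOn.prodMk ?_
      refine (stereographic' n (-p)).continuousOn.comp
        ((continuousOn_radialProjection p).comp continuous_subtype_val.continuousOn
          fun x hx => hx.1) fun x hx => ?_
      exact radialProjection_mem_source_stereographic' hx.1 hx.2
    exact hF.comp_continuousOn hG
  continuousOn_invFun := by
    refine Continuous.continuousOn (Continuous.subtype_mk ?_ _)
    have h0 : Continuous fun z : EuclideanHalfSpace (n + 1) => z.val 0 := by fun_prop
    have h1 : Continuous fun z : EuclideanHalfSpace (n + 1) =>
        (toLp 2 fun i : Fin n => z.val i.succ : 𝔼 n) := by fun_prop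
    have h2 : Continuous (stereographic' n (-p)).symm := by
      rw [← continuousOn_univ, ← stereographic'_target (-p)]
      exact (stereographic' n (-p)).continuousOn_symm
    exact (continuous_const.sub (h0.min continuous_const)).smul
      (continuous_subtype_val.comp (h2.comp h1))

/-- The `0`-th coordinate of the (extended) interior chart at `x` is `x 0 + 2`. [folklore] -/
theorem closedBallInteriorChart_extend_apply_zero (x : 𝔻 (n + 1)) :
    (closedBallInteriorChart n).extend (𝓡∂ (n + 1)) x 0 = (x : 𝔼 (n + 1)) 0 + 2 := by
  simp [OpenPartialHomeomorph.extend, closedBallInteriorChart, modelWithCornersEuclideanHalfSpace]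

variable {n} in
/-- The `0`-th coordinate of the (extended) boundary chart at `x` is `1 - ‖x‖`. [folklore] -/
theorem closedBallBoundaryChart_extend_apply_zero (p : 𝕊 n) (x : 𝔻 (n + 1)) :
    (closedBallBoundaryChart p).extend (𝓡∂ (n + 1)) x 0 = 1 - ‖(x : 𝔼 (n + 1))‖ := by
  simp [OpenPartialHomeomorph.extend, closedBallBoundaryChart, modelWithCornersEuclideanHalfSpace]

/-- The source of the interior chart is the open unit ball (definitional). [folklore] -/
@[simp]
theorem closedBallInteriorChart_source :
    (closedBallInteriorChart n).source = {x : 𝔻 (n + 1) | ‖(x : 𝔼 (n + 1))‖ < 1} := rfl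

/-- The interior chart is the translation by `2 • e₀` (definitional). [folklore] -/
@[simp]
theorem coe_closedBallInteriorChart_apply (x : 𝔻 (n + 1)) :
    (closedBallInteriorChart n x).val = (x : 𝔼 (n + 1)) + (2 : ℝ) • closedBallBaseVector n := rfl

variable {n} in
/-- The source of the boundary chart at `p` (definitional). [folklore] -/
@[simp]
theorem closedBallBoundaryChart_source (p : 𝕊 n) :
    (closedBallBoundaryChart p).source =
      {x : 𝔻 (n + 1) |
        (x : 𝔼 (n + 1)) ≠ 0 ∧ ‖(x : 𝔼 (n + 1))‖⁻¹ • (x : 𝔼 (n + 1)) ≠ -(p : 𝔼 (n + 1))} :=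
  rfl

variable {n} in
/-- The target of the boundary chart at `p` is `{z | z 0 < 1}` (definitional). [folklore] -/
@[simp]
theorem closedBallBoundaryChart_target (p : 𝕊 n) :
    (closedBallBoundaryChart p).target = {z | z.val 0 < 1} := rfl

variable {n} in
/-- The first coordinate of the boundary chart is `1 - ‖x‖`. [folklore] -/
@[simp]
theorem coe_closedBallBoundaryChart_apply_zero (p : 𝕊 n) (x : 𝔻 (n + 1)) :
    (closedBallBoundaryChart p x).val 0 = 1 - ‖(x : 𝔼 (n + 1))‖ := by
  simp [closedBallBoundaryChart]

variable {n} in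
/-- The other coordinates of the boundary chart are the stereographic coordinates (from the pole
`-p`) of the direction `x / ‖x‖`. [folklore] -/
@[simp]
theorem coe_closedBallBoundaryChart_apply_succ (p : 𝕊 n) (x : 𝔻 (n + 1)) (i : Fin n) :
    (closedBallBoundaryChart p x).val i.succ =
      stereographic' n (-p) (radialProjection p x) i := by
  simp [closedBallBoundaryChart]

/-- The unit sphere lies in the source of each boundary chart except at the antipode `-p`. [folklore] -/
theorem inclusion_mem_closedBallBoundaryChart_source {p x : 𝕊 n} (h : x ≠ -p) :
    Set.inclusion sphere_subset_closedBall x ∈ (closedBallBoundaryChart p).source := by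
  refine ⟨ne_zero_of_mem_unit_sphere x, ?_⟩
  change ‖(x : 𝔼 (n + 1))‖⁻¹ • (x : 𝔼 (n + 1)) ≠ -(p : 𝔼 (n + 1))
  rw [norm_eq_of_mem_sphere, inv_one, one_smul, ← coe_neg_sphere]
  exact fun h' => h (Subtype.ext h')

/-! ### The charted space structure -/

/-- **The closed ball `𝔻ⁿ⁺¹` is a charted space modelled on the half-space
`EuclideanHalfSpace (n + 1)`.** The atlas consists of the interior chart and the boundary charts
`closedBallBoundaryChart p`, `p : 𝕊ⁿ`; the preferred chart at `x` is the interior chart if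
`‖x‖ < 1` and the boundary chart at `x` itself if `‖x‖ = 1`. Lee, *Introduction to Smooth
Manifolds* (2013), Ch. 1 (manifolds with boundary; `𝔹̄ⁿ`); Hirsch, *Differential Topology*
(1976), §1.4. Mathlib has the analogous `instIccChartedSpace` (dimension one) only. [folklore] -/
instance instChartedSpaceClosedBall : ChartedSpace (EuclideanHalfSpace (n + 1)) (𝔻 (n + 1)) where
  atlas := insert (closedBallInteriorChart n) (range (closedBallBoundaryChart (n := n)))
  chartAt x := if h : ‖(x : 𝔼 (n + 1))‖ < 1 then closedBallInteriorChart n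
    else closedBallBoundaryChart
      ⟨x, mem_sphere_zero_iff_norm.2 ((mem_closedBall_zero_iff.1 x.2).antisymm (not_lt.1 h))⟩
  mem_chart_source x := by
    by_cases h : ‖(x : 𝔼 (n + 1))‖ < 1
    · rw [dif_pos h]
      exact h
    · rw [dif_neg h]
      have h1 : ‖(x : 𝔼 (n + 1))‖ = 1 := (mem_closedBall_zero_iff.1 x.2).antisymm (not_lt.1 h)
      refine ⟨norm_ne_zero_iff.1 (by rw [h1]; exact one_ne_zero), ?_⟩
      intro hx
      change ‖(x : 𝔼 (n + 1))‖⁻¹ • (x : 𝔼 (n + 1)) = -(x : 𝔼 (n + 1)) at hx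
      rw [h1, inv_one, one_smul] at hx
      exact ne_neg_of_mem_unit_sphere ℝ (⟨x, mem_sphere_zero_iff_norm.2 h1⟩ : 𝕊 n)
        (Subtype.ext hx)
  chart_mem_atlas x := by
    by_cases h : ‖(x : 𝔼 (n + 1))‖ < 1
    · rw [dif_pos h]
      exact mem_insert _ _
    · rw [dif_neg h]
      exact mem_insert_of_mem _ (mem_range_self _)

/-- The atlas of `𝔻ⁿ⁺¹`: the interior chart and the boundary charts (definitional). [folklore] -/
theorem closedBall_atlas : atlas (EuclideanHalfSpace (n + 1)) (𝔻 (n + 1)) =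
    insert (closedBallInteriorChart n) (range (closedBallBoundaryChart (n := n))) := rfl

/-- `𝔻ⁿ⁺¹` is compact (Mathlib's `ProperSpace` instance for closed balls; recorded here as a
sanity check of the conventions `[CompactSpace M]` of the consumers). -/
example : CompactSpace (𝔻 (n + 1)) := inferInstance

variable {n}

/-- At an interior point `‖x‖ < 1` the preferred chart of `𝔻ⁿ⁺¹` is the interior chart. [folklore] -/
theorem closedBall_chartAt_of_norm_lt_one {x : 𝔻 (n + 1)} (h : ‖(x : 𝔼 (n + 1))‖ < 1) :
    chartAt (EuclideanHalfSpace (n + 1)) x = closedBallInteriorChart n :=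
  dif_pos h

/-- At a boundary point `‖x‖ = 1` the preferred chart of `𝔻ⁿ⁺¹` is the boundary chart at `x`. [folklore] -/
theorem closedBall_chartAt_of_norm_eq_one {x : 𝔻 (n + 1)} (h : ‖(x : 𝔼 (n + 1))‖ = 1) :
    chartAt (EuclideanHalfSpace (n + 1)) x =
      closedBallBoundaryChart (⟨x, mem_sphere_zero_iff_norm.2 h⟩ : 𝕊 n) :=
  dif_neg (by rw [h]; exact lt_irrefl 1)

variable (n)

/-! ### Smooth compatibility of the atlas -/

section Compatibility

variable {n}

/-- The model with corners `𝓡∂ (n + 1)` is the inclusion of the half-space (definitional). [folklore] -/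
theorem modelWithCornersEuclideanHalfSpace_apply (z : EuclideanHalfSpace (n + 1)) :
    (𝓡∂ (n + 1)) z = z.val := rfl

/-- The boundary chart in coordinates (definitional unfolding). [folklore] -/
theorem coe_closedBallBoundaryChart_apply (p : 𝕊 n) (x : 𝔻 (n + 1)) :
    (closedBallBoundaryChart p x).val = toLp 2 (Fin.cons (1 - ‖(x : 𝔼 (n + 1))‖)
      (ofLp (stereographic' n (-p) (radialProjection p x))) : Fin (n + 1) → ℝ) := rfl

/-- The inverse of the boundary chart on its target: `z ↦ (1 - z 0) • σ⁻¹ (z 1, …, z n)`. [folklore] -/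
theorem coe_closedBallBoundaryChart_symm_apply (p : 𝕊 n) {z : EuclideanHalfSpace (n + 1)}
    (hz : z.val 0 ≤ 1) :
    (((closedBallBoundaryChart p).symm z : 𝔻 (n + 1)) : 𝔼 (n + 1)) = (1 - z.val 0) •
      ((stereographic' n (-p)).symm (toLp 2 fun i : Fin n => z.val i.succ) : 𝔼 (n + 1)) := by
  change (1 - min (z.val 0) 1) • _ = _
  rw [min_eq_left hz]

/-- The inverse of the interior chart on its target: `z ↦ z - 2 • e₀`. [folklore] -/
theorem coe_closedBallInteriorChart_symm_apply {z : EuclideanHalfSpace (n + 1)}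
    (hz : ‖z.val - (2 : ℝ) • closedBallBaseVector n‖ ≤ 1) :
    (((closedBallInteriorChart n).symm z : 𝔻 (n + 1)) : 𝔼 (n + 1)) =
      z.val - (2 : ℝ) • closedBallBaseVector n :=
  closedBallRetraction_of_norm_le (n + 1) hz

/-- Mathlib's `stereographic' n v` is `stereoToFun v` followed by the chosen linear isometry
`(ℝ ∙ v)ᗮ ≃ₗᵢ ℝⁿ` (definitional unfolding). [folklore] -/
theorem stereographic'_eq_repr_stereoToFun (v x : 𝕊 n) :
    stereographic' n v x = (OrthonormalBasis.fromOrthogonalSpanSingleton n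
      (ne_zero_of_mem_unit_sphere v)).repr (stereoToFun (v : 𝔼 (n + 1)) (x : 𝔼 (n + 1))) := rfl

/-- The inverse of Mathlib's `stereographic' n v` in coordinates: `stereoInvFunAux v` after the
inverse linear isometry (definitional unfolding). [folklore] -/
theorem coe_stereographic'_symm (v : 𝕊 n) (w : 𝔼 n) :
    (((stereographic' n v).symm w : 𝕊 n) : 𝔼 (n + 1)) = stereoInvFunAux (v : 𝔼 (n + 1))
      ((OrthonormalBasis.fromOrthogonalSpanSingleton n
        (ne_zero_of_mem_unit_sphere v)).repr.symm w : 𝔼 (n + 1)) := rfl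

/-- The inverse stereographic chart, viewed in `ℝⁿ⁺¹`, is smooth on all of `ℝⁿ` (Mathlib
`contDiff_stereoInvFunAux`). [folklore] -/
theorem contDiff_coe_stereographic'_symm (v : 𝕊 n) :
    ContDiff ℝ ∞ fun w : 𝔼 n => (((stereographic' n v).symm w : 𝕊 n) : 𝔼 (n + 1)) := by
  simp_rw [coe_stereographic'_symm]
  exact (contDiff_stereoInvFunAux.comp (ℝ ∙ (v : 𝔼 (n + 1)))ᗮ.subtypeL.contDiff).comp
    (LinearIsometryEquiv.contDiff _)

/-- The stereographic chart from the pole `v`, viewed on `ℝⁿ⁺¹` via `stereoToFun`, is smooth at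
every unit vector other than `v`, and so is its composition with a map smooth at a point
(Mathlib `contDiffOn_stereoToFun`). [folklore] -/
theorem contDiffAt_repr_stereoToFun_comp (v : 𝕊 n) {f : 𝔼 (n + 1) → 𝔼 (n + 1)}
    {y : 𝔼 (n + 1)} (hf : ContDiffAt ℝ ∞ f y) (h1 : ‖f y‖ = 1) (hv : f y ≠ (v : 𝔼 (n + 1))) :
    ContDiffAt ℝ ∞ (fun y => (OrthonormalBasis.fromOrthogonalSpanSingleton n
      (ne_zero_of_mem_unit_sphere v)).repr (stereoToFun (v : 𝔼 (n + 1)) (f y))) y := by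
  refine (LinearIsometryEquiv.contDiff _).comp_contDiffAt y
    (ContDiffAt.comp (g := stereoToFun (v : 𝔼 (n + 1))) y ?_ hf)
  refine contDiffOn_stereoToFun.contDiffAt ((isOpen_ne_fun (innerSL ℝ _).continuous
    continuous_const).mem_nhds ?_)
  rw [mem_setOf_eq, innerSL_apply_apply]
  intro h
  have := (sphere_ext_iff v ⟨f y, mem_sphere_zero_iff_norm.2 h1⟩).2 h
  exact hv (congrArg Subtype.val this).symm

/-- Dropping the first coordinate, `ℝⁿ⁺¹ → ℝⁿ`, is smooth (it is linear). [folklore] -/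
theorem contDiff_euclideanSpace_tail :
    ContDiff ℝ ∞ (fun y : 𝔼 (n + 1) => (toLp 2 fun i : Fin n => y i.succ : 𝔼 n)) :=
  contDiff_piLp' 2 fun i => contDiff_piLp_apply 2 (i := i.succ)

/-- Reduction of the compatibility condition of `isManifold_of_contDiffOn` for two charts of
`𝔻ⁿ⁺¹` to: the transition map agrees, at every relevant half-space point `z`, with a map
`g : ℝⁿ⁺¹ → ℝⁿ⁺¹` which is smooth at `z`. [folklore] -/
theorem contDiffOn_transition_of {e e' : OpenPartialHomeomorph (𝔻 (n + 1))
    (EuclideanHalfSpace (n + 1))} (g : 𝔼 (n + 1) → 𝔼 (n + 1))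
    (h : ∀ z : EuclideanHalfSpace (n + 1), z ∈ e.target → e.symm z ∈ e'.source →
      ContDiffAt ℝ ∞ g z.val ∧ (e' (e.symm z)).val = g z.val) :
    ContDiffOn ℝ ∞ ((𝓡∂ (n + 1)) ∘ (e.symm ≫ₕ e') ∘ (𝓡∂ (n + 1)).symm)
      ((𝓡∂ (n + 1)).symm ⁻¹' (e.symm ≫ₕ e').source ∩ range (𝓡∂ (n + 1))) := by
  have key : ∀ y ∈ (𝓡∂ (n + 1)).symm ⁻¹' (e.symm ≫ₕ e').source ∩ range (𝓡∂ (n + 1)),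
      ∃ z : EuclideanHalfSpace (n + 1), y = z.val ∧ z ∈ e.target ∧ e.symm z ∈ e'.source := by
    rintro _ ⟨hy, z, rfl⟩
    simp only [mem_preimage, ModelWithCorners.left_inv, OpenPartialHomeomorph.trans_source,
      OpenPartialHomeomorph.symm_source, mem_inter_iff] at hy
    exact ⟨z, rfl, hy.1, hy.2⟩
  have hF : ∀ y ∈ (𝓡∂ (n + 1)).symm ⁻¹' (e.symm ≫ₕ e').source ∩ range (𝓡∂ (n + 1)),
      ((𝓡∂ (n + 1)) ∘ (e.symm ≫ₕ e') ∘ (𝓡∂ (n + 1)).symm) y = g y := by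
    intro y hy
    obtain ⟨z, rfl, hz, hz'⟩ := key y hy
    rw [Function.comp_apply, Function.comp_apply, ← modelWithCornersEuclideanHalfSpace_apply z,
      ModelWithCorners.left_inv, OpenPartialHomeomorph.coe_trans, Function.comp_apply,
      modelWithCornersEuclideanHalfSpace_apply, modelWithCornersEuclideanHalfSpace_apply]
    exact (h z hz hz').2
  intro y hy
  obtain ⟨z, rfl, hz, hz'⟩ := key y hy
  exact (h z hz hz').1.contDiffWithinAt.congr hF (hF _ hy)

variable (n)

/-- Compatibility of the interior chart with itself (the transition map is the identity). [folklore] -/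
theorem contDiffOn_closedBall_transition_interior_interior :
    ContDiffOn ℝ ∞ ((𝓡∂ (n + 1)) ∘ ((closedBallInteriorChart n).symm ≫ₕ
      closedBallInteriorChart n) ∘ (𝓡∂ (n + 1)).symm)
      ((𝓡∂ (n + 1)).symm ⁻¹' ((closedBallInteriorChart n).symm ≫ₕ
        closedBallInteriorChart n).source ∩ range (𝓡∂ (n + 1))) :=
  contDiffOn_transition_of id fun _ hz _ =>
    ⟨contDiffAt_id, congrArg Subtype.val ((closedBallInteriorChart n).right_inv hz)⟩

variable {n} in
/-- Compatibility of the interior chart followed by a boundary chart: the transition map is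
`y ↦ (1 - ‖y - 2e₀‖, σ_q ((y - 2e₀) / ‖y - 2e₀‖))`, smooth off `y = 2e₀`. [folklore] -/
theorem contDiffOn_closedBall_transition_interior_boundary (q : 𝕊 n) :
    ContDiffOn ℝ ∞ ((𝓡∂ (n + 1)) ∘ ((closedBallInteriorChart n).symm ≫ₕ
      closedBallBoundaryChart q) ∘ (𝓡∂ (n + 1)).symm)
      ((𝓡∂ (n + 1)).symm ⁻¹' ((closedBallInteriorChart n).symm ≫ₕ
        closedBallBoundaryChart q).source ∩ range (𝓡∂ (n + 1))) := by
  set c : 𝔼 (n + 1) := (2 : ℝ) • closedBallBaseVector n with hc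
  refine contDiffOn_transition_of (fun y => toLp 2 (Fin.cons (1 - ‖y - c‖)
    (ofLp ((OrthonormalBasis.fromOrthogonalSpanSingleton n
      (ne_zero_of_mem_unit_sphere (-q))).repr
        (stereoToFun ((-q : 𝕊 n) : 𝔼 (n + 1)) (‖y - c‖⁻¹ • (y - c))))) : Fin (n + 1) → ℝ))
    fun z hz hz' => ?_
  have hv : (((closedBallInteriorChart n).symm z : 𝔻 (n + 1)) : 𝔼 (n + 1)) = z.val - c :=
    coe_closedBallInteriorChart_symm_apply (le_of_lt hz)
  change ((((closedBallInteriorChart n).symm z : 𝔻 (n + 1)) : 𝔼 (n + 1)) ≠ 0 ∧ _) at hz'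
  rw [hv] at hz'
  obtain ⟨h0, hq⟩ := hz'
  have hsub : ContDiffAt ℝ ∞ (fun y : 𝔼 (n + 1) => y - c) z.val :=
    contDiffAt_id.sub contDiffAt_const
  have hnorm : ContDiffAt ℝ ∞ (fun y : 𝔼 (n + 1) => ‖y - c‖) z.val := hsub.norm ℝ h0
  constructor
  · refine contDiffAt_piLp' 2 fun i => ?_
    refine Fin.cases ?_ (fun j => ?_) i
    · simp only [Fin.cons_zero]
      exact contDiffAt_const.sub hnorm
    · simp only [Fin.cons_succ]
      refine (contDiffAt_piLp_apply 2).comp _ (contDiffAt_repr_stereoToFun_comp (-q)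
        ((hnorm.inv (norm_ne_zero_iff.2 h0)).smul hsub) ?_ ?_)
      · rw [norm_smul, norm_inv, norm_norm, inv_mul_cancel₀ (norm_ne_zero_iff.2 h0)]
      · rwa [coe_neg_sphere]
  · rw [coe_closedBallBoundaryChart_apply, hv, stereographic'_eq_repr_stereoToFun,
      coe_radialProjection_of_ne_zero q h0]

variable {n} in
/-- Compatibility of a boundary chart followed by the interior chart: the transition map is
`y ↦ (1 - y 0) • σ_p⁻¹ (y 1, …, y n) + 2e₀`, smooth everywhere. [folklore] -/
theorem contDiffOn_closedBall_transition_boundary_interior (p : 𝕊 n) :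
    ContDiffOn ℝ ∞ ((𝓡∂ (n + 1)) ∘ ((closedBallBoundaryChart p).symm ≫ₕ
      closedBallInteriorChart n) ∘ (𝓡∂ (n + 1)).symm)
      ((𝓡∂ (n + 1)).symm ⁻¹' ((closedBallBoundaryChart p).symm ≫ₕ
        closedBallInteriorChart n).source ∩ range (𝓡∂ (n + 1))) := by
  refine contDiffOn_transition_of (fun y => (1 - y 0) •
    (((stereographic' n (-p)).symm (toLp 2 fun i : Fin n => y i.succ) : 𝕊 n) : 𝔼 (n + 1)) +
      (2 : ℝ) • closedBallBaseVector n) fun z hz _ => ⟨?_, ?_⟩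
  · refine ContDiff.contDiffAt ?_
    have h0 : ContDiff ℝ ∞ (fun y : 𝔼 (n + 1) => 1 - y 0) :=
      contDiff_const.sub (contDiff_piLp_apply 2)
    exact (h0.smul ((contDiff_coe_stereographic'_symm (-p)).comp contDiff_euclideanSpace_tail)).add
      contDiff_const
  · rw [coe_closedBallInteriorChart_apply, coe_closedBallBoundaryChart_symm_apply p (le_of_lt hz)]

variable {n} in
/-- Compatibility of two boundary charts: the transition map is
`y ↦ (y 0, σ_q (σ_p⁻¹ (y 1, …, y n)))`, smooth where defined. [folklore] -/
theorem contDiffOn_closedBall_transition_boundary_boundary (p q : 𝕊 n) :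
    ContDiffOn ℝ ∞ ((𝓡∂ (n + 1)) ∘ ((closedBallBoundaryChart p).symm ≫ₕ
      closedBallBoundaryChart q) ∘ (𝓡∂ (n + 1)).symm)
      ((𝓡∂ (n + 1)).symm ⁻¹' ((closedBallBoundaryChart p).symm ≫ₕ
        closedBallBoundaryChart q).source ∩ range (𝓡∂ (n + 1))) := by
  refine contDiffOn_transition_of (fun y => toLp 2 (Fin.cons (y 0)
    (ofLp ((OrthonormalBasis.fromOrthogonalSpanSingleton n
      (ne_zero_of_mem_unit_sphere (-q))).repr
        (stereoToFun ((-q : 𝕊 n) : 𝔼 (n + 1))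
          (((stereographic' n (-p)).symm (toLp 2 fun i : Fin n => y i.succ) : 𝕊 n) :
            𝔼 (n + 1))))) : Fin (n + 1) → ℝ))
    fun z hz hz' => ?_
  have ht : 0 < 1 - z.val 0 := sub_pos.2 hz
  set s : 𝕊 n := (stereographic' n (-p)).symm (toLp 2 fun i : Fin n => z.val i.succ) with hs_def
  have hs : (((closedBallBoundaryChart p).symm z : 𝔻 (n + 1)) : 𝔼 (n + 1)) =
      (1 - z.val 0) • (s : 𝔼 (n + 1)) :=
    coe_closedBallBoundaryChart_symm_apply p (le_of_lt hz)
  change ((((closedBallBoundaryChart p).symm z : 𝔻 (n + 1)) : 𝔼 (n + 1)) ≠ 0 ∧ _) at hz'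
  rw [hs, norm_smul_coe_sphere ht.le, smul_smul, inv_mul_cancel₀ ht.ne', one_smul] at hz'
  obtain ⟨-, hq⟩ := hz'
  constructor
  · refine contDiffAt_piLp' 2 fun i => ?_
    refine Fin.cases ?_ (fun j => ?_) i
    · simp only [Fin.cons_zero]
      exact contDiffAt_piLp_apply 2
    · simp only [Fin.cons_succ]
      refine (contDiffAt_piLp_apply 2).comp _ (contDiffAt_repr_stereoToFun_comp (-q)
        (((contDiff_coe_stereographic'_symm (-p)).comp
          contDiff_euclideanSpace_tail).contDiffAt) ?_ ?_)
      · exact norm_eq_of_mem_sphere _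
      · rwa [coe_neg_sphere]
  · rw [coe_closedBallBoundaryChart_apply, hs, norm_smul_coe_sphere ht.le,
      radialProjection_smul q ht, sub_sub_cancel, stereographic'_eq_repr_stereoToFun]

end Compatibility

/-- **The closed ball is a smooth manifold with boundary**: the atlas
`instChartedSpaceClosedBall` of `𝔻ⁿ⁺¹` is `C^∞`-compatible for the model with corners
`𝓡∂ (n + 1)`. Real proof: the four kinds of transition maps are compositions of translations,
`x ↦ ‖x‖` off the origin, and Mathlib's analytic `stereoToFun` / `stereoInvFunAux`
(`contDiffOn_closedBall_transition_*`). Lee, *Introduction to Smooth Manifolds* (2013), Ch. 1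
(Problem 1-11) and Prop. 5.47 (`𝔹̄ⁿ` is a regular domain); Hirsch, *Differential Topology*
(1976), §1.4. Mathlib has the one-dimensional analogue `instIsManifoldIcc` only. [folklore] -/
instance instIsManifoldClosedBall : IsManifold (𝓡∂ (n + 1)) ∞ (𝔻 (n + 1)) := by
  apply isManifold_of_contDiffOn
  rintro e e' (rfl | ⟨p, rfl⟩) (rfl | ⟨q, rfl⟩)
  · exact contDiffOn_closedBall_transition_interior_interior n
  · exact contDiffOn_closedBall_transition_interior_boundary q
  · exact contDiffOn_closedBall_transition_boundary_interior p
  · exact contDiffOn_closedBall_transition_boundary_boundary p q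

/-- **The boundary of the closed ball is the unit sphere**: `∂𝔻ⁿ⁺¹ = {x | ‖x‖ = 1}` for the
model with corners `𝓡∂ (n + 1)` (real proof from the explicit charts: the `0`-th model
coordinate of the preferred chart at `x` is `x 0 + 2 > 0` if `‖x‖ < 1` and `1 - ‖x‖ = 0` if
`‖x‖ = 1`). Lee, *Introduction to Smooth Manifolds* (2013), Ch. 1 (Problem 1-11); compare
Mathlib's `boundary_Icc`. [folklore] -/
theorem boundary_closedBall :
    (𝓡∂ (n + 1)).boundary (𝔻 (n + 1)) = {x : 𝔻 (n + 1) | ‖(x : 𝔼 (n + 1))‖ = 1} := by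
  ext x
  rw [ModelWithCorners.boundary, mem_setOf_eq, ModelWithCorners.isBoundaryPoint_iff, extChartAt,
    frontier_range_modelWithCornersEuclideanHalfSpace, mem_setOf_eq, mem_setOf_eq]
  by_cases h : ‖(x : 𝔼 (n + 1))‖ < 1
  · rw [closedBall_chartAt_of_norm_lt_one h, closedBallInteriorChart_extend_apply_zero]
    have := neg_one_le_coe_closedBall_apply x 0
    constructor <;> intro h' <;> linarith
  · have h1 : ‖(x : 𝔼 (n + 1))‖ = 1 := (mem_closedBall_zero_iff.1 x.2).antisymm (not_lt.1 h)
    rw [closedBall_chartAt_of_norm_eq_one h1, closedBallBoundaryChart_extend_apply_zero, h1]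
    simp

/-- **The interior of the closed ball is the open ball**: `Int 𝔻ⁿ⁺¹ = {x | ‖x‖ < 1}` for the
model with corners `𝓡∂ (n + 1)` (complement of `boundary_closedBall`). Lee, *Introduction to
Smooth Manifolds* (2013), Ch. 1 (Problem 1-11). [folklore] -/
theorem interior_closedBall :
    (𝓡∂ (n + 1)).interior (𝔻 (n + 1)) = {x : 𝔻 (n + 1) | ‖(x : 𝔼 (n + 1))‖ < 1} := by
  rw [← ModelWithCorners.compl_boundary, boundary_closedBall]
  ext x
  simp only [mem_compl_iff, mem_setOf_eq]
  exact ⟨fun h => lt_of_le_of_ne (mem_closedBall_zero_iff.1 x.2) h, fun h => h.ne⟩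

/-! ### The boundary datum `𝕊ⁿ = ∂𝔻ⁿ⁺¹` -/

/-- **The inclusion `𝕊ⁿ ↪ 𝔻ⁿ⁺¹` is a smooth embedding** of the analytic manifold `𝕊ⁿ` (Mathlib's
stereographic atlas, model `𝓡 n`) into the closed ball with the atlas
`instChartedSpaceClosedBall` (model `𝓡∂ (n + 1)`): in the boundary chart at `p` and the chart
`stereographic' n (-p)` of `𝕊ⁿ` it reads `w ↦ (0, w)`. Lee, *Introduction to Smooth Manifolds*
(2013), Thm. 5.11 (`∂M` is an embedded hypersurface) with Problem 1-11 (`∂𝔹̄ⁿ = 𝕊ⁿ⁻¹`). The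
prime distinguishes this from G18's `Literature.Topology.FourManifolds.isSmoothEmbedding_sphereInclusion` (equatorial
inclusions `𝕊ᵏ ↪ 𝕊ⁿ`). Absent from Mathlib (no manifold structure on closed balls). Downstream
definitions take it as the instance hypothesis `[Fact (isSmoothEmbedding_sphereInclusion' n)]`. [cite: Lee2013, Thm. 5.11 with Problem 1-11] -/
def isSmoothEmbedding_sphereInclusion' : Prop :=
  Manifold.IsSmoothEmbedding (𝓡 n) (𝓡∂ (n + 1)) ∞
      (Set.inclusion (sphere_subset_closedBall : 𝕊 n ⊆ 𝔻 (n + 1)))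

/-- The range of the inclusion `𝕊ⁿ ↪ 𝔻ⁿ⁺¹` is the boundary `∂𝔻ⁿ⁺¹` (real, from
`boundary_closedBall`). Lee, *Introduction to Smooth Manifolds* (2013), Problem 1-11. [folklore] -/
theorem range_inclusion_eq_boundary :
    range (Set.inclusion (sphere_subset_closedBall : 𝕊 n ⊆ 𝔻 (n + 1))) =
      (𝓡∂ (n + 1)).boundary (𝔻 (n + 1)) := by
  rw [range_inclusion, boundary_closedBall]
  ext x
  simp

/-- **The boundary datum of the closed ball**: `∂𝔻ⁿ⁺¹` *is* the unit sphere `𝕊ⁿ` with its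
Mathlib (stereographic, analytic) manifold structure, included by `Set.inclusion`. This is the
G18 structure `Literature.Topology.FourManifolds.BoundaryData` (carrier, inclusion, smooth embedding, range = boundary) for
`M = 𝔻ⁿ⁺¹`, models `𝓡∂ (n + 1)` and `𝓡 n`. Lee, *Introduction to Smooth Manifolds* (2013),
Problem 1-11 and Thm. 5.11. Relies on: `isSmoothEmbedding_sphereInclusion'` (named fact, taken as
the instance hypothesis `[Fact (isSmoothEmbedding_sphereInclusion' n)]`),
`range_inclusion_eq_boundary` (proved). [folklore] -/
def closedBallBoundaryData [h : Fact (isSmoothEmbedding_sphereInclusion' n)] :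
    BoundaryData (𝓡∂ (n + 1)) (𝔻 (n + 1)) (𝓡 n) where
  carrier := 𝕊 n
  incl := Set.inclusion sphere_subset_closedBall
  isSmoothEmbedding := h.out
  range_incl := range_inclusion_eq_boundary n

/-- The carrier of the boundary datum of `𝔻ⁿ⁺¹` is `𝕊ⁿ` (definitional). [folklore] -/
@[simp]
theorem closedBallBoundaryData_carrier [Fact (isSmoothEmbedding_sphereInclusion' n)] :
    (closedBallBoundaryData n).carrier = (𝕊 n) := rfl

/-- The inclusion of the boundary datum of `𝔻ⁿ⁺¹` is `Set.inclusion` (definitional). [folklore] -/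
@[simp]
theorem closedBallBoundaryData_incl [Fact (isSmoothEmbedding_sphereInclusion' n)] :
    (closedBallBoundaryData n).incl = Set.inclusion sphere_subset_closedBall := rfl

/-! ### Sanity statements: the double of the ball and the radial collar -/

/-- **`𝕊ⁿ⁺¹` is the double of `𝔻ⁿ⁺¹`**: the sphere `𝕊ⁿ⁺¹` is obtained by gluing two copies of
the closed ball `𝔻ⁿ⁺¹` along the identity of `∂𝔻ⁿ⁺¹ = 𝕊ⁿ` (the two closed hemispheres
`{x | 0 ≤ ± x (n + 1)}` are smoothly embedded copies of `𝔻ⁿ⁺¹`, e.g. via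
`x ↦ (x, ±√(1 - ‖x‖²))`, smooth also at the equator in the boundary charts, and they meet
exactly along the equator `𝕊ⁿ`). Hirsch, *Differential Topology* (1976), §8.2, Example;
Bröcker–Jänich, *Introduction to Differential Topology* (1982), §13; Kosinski, *Differential
Manifolds* (1993), VI.5. Uses `Literature.Topology.FourManifolds.IsDouble` of `Literature.Prelude.FourManL.Gluing`. [cite: Hirsch1976, §8.2 Example] -/
def isDouble_sphere [Fact (isSmoothEmbedding_sphereInclusion' n)] : Prop :=
  IsDouble (closedBallBoundaryData n) (𝓡 (n + 1)) (𝕊 (n + 1))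

/-- **The radial collar map** of `∂𝔻ⁿ⁺¹ = 𝕊ⁿ`: `(x, t) ↦ (1 - t / 2) • x` for `x ∈ 𝕊ⁿ`,
`t ∈ [0, 1]`, a map `𝕊ⁿ × [0, 1] → 𝔻ⁿ⁺¹` onto the closed annulus `{x | 1/2 ≤ ‖x‖ ≤ 1}`
restricting to the inclusion on `𝕊ⁿ × {0}`. Defined (with its elementary API) for every `n`;
it is a collar in the sense of `Literature.Topology.FourManifolds.BoundaryData.Collar` only for `n ≥ 1`, see
`isSmoothEmbedding_closedBallCollarMap`. The dimension `n` is explicit since the map is mostly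
used unapplied. Hirsch, *Differential Topology* (1976), §4.6 (collars), here completely
explicit. [folklore] -/
def closedBallCollarMap (q : (𝕊 n) × Set.Icc (0 : ℝ) 1) : 𝔻 (n + 1) :=
  ⟨(1 - (q.2 : ℝ) / 2) • (q.1 : 𝔼 (n + 1)), by
    rw [mem_closedBall_zero_iff, norm_smul_coe_sphere (by linarith [q.2.2.2])]
    linarith [q.2.2.1]⟩

variable {n} in
/-- The value of the radial collar map in `ℝⁿ⁺¹` (definitional). [folklore] -/
@[simp]
theorem coe_closedBallCollarMap (q : (𝕊 n) × Set.Icc (0 : ℝ) 1) :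
    (closedBallCollarMap n q : 𝔼 (n + 1)) = (1 - (q.2 : ℝ) / 2) • (q.1 : 𝔼 (n + 1)) := rfl

variable {n} in
/-- The radial collar map has norm `‖(1 - t/2) • x‖ = 1 - t/2`. [folklore] -/
theorem norm_coe_closedBallCollarMap (q : (𝕊 n) × Set.Icc (0 : ℝ) 1) :
    ‖(closedBallCollarMap n q : 𝔼 (n + 1))‖ = 1 - (q.2 : ℝ) / 2 :=
  norm_smul_coe_sphere (by linarith [q.2.2.2]) q.1

/-- The radial collar map is continuous. [folklore] -/
theorem continuous_closedBallCollarMap : Continuous (closedBallCollarMap n) := by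
  refine Continuous.subtype_mk ?_ _
  fun_prop

/-- The radial collar map is injective (norms determine `t`, then directions determine `x`). [folklore] -/
theorem injective_closedBallCollarMap : Injective (closedBallCollarMap n) := by
  rintro ⟨x, t⟩ ⟨y, s⟩ h
  have hn := congrArg (fun z : 𝔻 (n + 1) => ‖(z : 𝔼 (n + 1))‖) h
  simp only [norm_coe_closedBallCollarMap] at hn
  have hts : (t : ℝ) = s := by linarith
  have ht : (0 : ℝ) < 1 - (t : ℝ) / 2 := by linarith [t.2.2]
  have hxy := congrArg (fun z : 𝔻 (n + 1) => (z : 𝔼 (n + 1))) h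
  simp only [coe_closedBallCollarMap, ← hts] at hxy
  have hxy' : (x : 𝔼 (n + 1)) = y := smul_right_injective _ ht.ne' hxy
  exact Prod.ext (Subtype.ext hxy') (Subtype.ext hts)

/-- On `𝕊ⁿ × {0}` the radial collar map is the inclusion `𝕊ⁿ ↪ 𝔻ⁿ⁺¹`. [folklore] -/
theorem closedBallCollarMap_apply_bot [Fact (isSmoothEmbedding_sphereInclusion' n)] (x : 𝕊 n) :
    closedBallCollarMap n (x, ⊥) = (closedBallBoundaryData n).incl x := by
  ext1
  simp [show ((⊥ : Set.Icc (0 : ℝ) 1) : ℝ) = 0 from rfl]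

/-- The image of the half-open collar `𝕊ⁿ × [0, 1)` under the radial collar map is the open
annulus `{x | 1/2 < ‖x‖}` of `𝔻ⁿ⁺¹`. [folklore] -/
theorem image_closedBallCollarMap :
    closedBallCollarMap n '' {q | (q.2 : ℝ) < 1} = {x : 𝔻 (n + 1) | 1 / 2 < ‖(x : 𝔼 (n + 1))‖} := by
  ext x
  simp only [mem_image, mem_setOf_eq]
  constructor
  · rintro ⟨q, hq, rfl⟩
    rw [norm_coe_closedBallCollarMap]
    linarith
  · intro hx
    have hx1 : ‖(x : 𝔼 (n + 1))‖ ≤ 1 := mem_closedBall_zero_iff.1 x.2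
    have hx0 : (x : 𝔼 (n + 1)) ≠ 0 := norm_pos_iff.1 (by linarith)
    refine ⟨(⟨‖(x : 𝔼 (n + 1))‖⁻¹ • (x : 𝔼 (n + 1)), by simp [norm_smul, hx0]⟩,
      ⟨2 * (1 - ‖(x : 𝔼 (n + 1))‖), by constructor <;> linarith⟩), by
        simp only; linarith, ?_⟩
    ext1
    simp only [coe_closedBallCollarMap]
    rw [show 1 - 2 * (1 - ‖(x : 𝔼 (n + 1))‖) / 2 = ‖(x : 𝔼 (n + 1))‖ by ring, smul_smul,
      mul_inv_cancel₀ (norm_ne_zero_iff.2 hx0), one_smul]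

/-- The image of the half-open radial collar is open in `𝔻ⁿ⁺¹`. [folklore] -/
theorem isOpen_image_closedBallCollarMap :
    IsOpen (closedBallCollarMap n '' {q | (q.2 : ℝ) < 1}) := by
  rw [image_closedBallCollarMap]
  exact isOpen_Ioi.preimage continuous_subtype_val.norm

/-- **The radial collar map is a smooth embedding** `𝕊ⁿ⁺¹ × [0, 1] ↪ 𝔻ⁿ⁺²` for the product
model with corners `(𝓡 (n + 1)).prod (𝓡∂ 1)` on the source and `𝓡∂ (n + 2)` on the target.
Hirsch, *Differential Topology* (1976), §4.6; Lee, *Introduction to Smooth Manifolds* (2013),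
Thm. 9.25 (collar neighbourhood theorem), explicit case.

The statement is made in ball dimension `n + 2` (sphere dimension `n + 1 ≥ 1`) because it is
*false* in ball dimension `1` for Mathlib's `Manifold.IsImmersion`: the source model of
`𝕊⁰ × [0, 1]` is `(𝓡 0).prod (𝓡∂ 1)` with model space `ℝ⁰ × ℝ¹`, whose model boundary is the
single point `0`; the corner `(x, ⊤)` is sent to `0` by every chart of the maximal atlas, so
`Manifold.ImmersionAtProp` (a *linear* `equiv : (ℝ⁰ × ℝ¹) × F ≃L ℝ¹` with
`ψ ∘ f ∘ φ⁻¹ = equiv ∘ (·, 0)`) forces the image `f (x, ⊤) = ± 1/2` to be a boundary point of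
`𝔻¹`, contradicting `interior_closedBall`. For sphere dimension `n + 1 ≥ 1` the domain coordinate
of `(x, ⊤)` in `stereographic' (n + 1) (-p) × IccRightChart` is `(w₀, 0)` with
`w₀ = σ_{-p} x ≠ 0` for a suitable pole `p`, and `equiv (w, s) := (⟪w, w₀⟫ / ‖w₀‖² - s, w)`
together with the target chart `ψ ∘ closedBallBoundaryChart p`,
`ψ (z₀, w) := (⟪w, w₀⟫ / ‖w₀‖² - (1 - 2 z₀), w)` (restricted to where it stays in the half-space)
realises the immersion property; away from `t = 1` the map reads `(w, t) ↦ (t / 2, w)` in the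
charts `stereographic' (n + 1) (-p) × IccLeftChart` and `closedBallBoundaryChart p`. [cite: Hirsch1976, §4.6] -/
def isSmoothEmbedding_closedBallCollarMap : Prop :=
  Manifold.IsSmoothEmbedding ((𝓡 (n + 1)).prod (𝓡∂ 1)) (𝓡∂ (n + 2)) ∞
    (closedBallCollarMap (n + 1))

/-- **The radial collar of `∂𝔻ⁿ⁺²`** (`n + 2 ≥ 2`), an explicit `Literature.Topology.FourManifolds.BoundaryData.Collar` of the
boundary datum `closedBallBoundaryData (n + 1)`: the map `(x, t) ↦ (1 - t / 2) • x`. In ball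
dimension `1` no collar in the sense of `Literature.Topology.FourManifolds.BoundaryData.Collar` exists (see
`isSmoothEmbedding_closedBallCollarMap` and `isEmpty_collar_closedBallBoundaryData_zero`), whence
the shift. Hirsch, *Differential Topology* (1976), §4.6. Relies on:
`isSmoothEmbedding_closedBallCollarMap` (named fact, hypothesis `h`);
`isOpen_image_closedBallCollarMap`, `closedBallCollarMap_apply_bot` (proved). [folklore] -/
def closedBallCollar [Fact (isSmoothEmbedding_sphereInclusion' (n + 1))]
    (h : isSmoothEmbedding_closedBallCollarMap n) : (closedBallBoundaryData (n + 1)).Collar where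
  toFun := closedBallCollarMap (n + 1)
  isSmoothEmbedding := h
  isOpen_image := isOpen_image_closedBallCollarMap (n + 1)
  apply_bot := closedBallCollarMap_apply_bot (n + 1)

/-- The boundary datum of the closed ball `𝔻ⁿ⁺²` (`n + 2 ≥ 2`) admits a collar (the explicit
radial collar `closedBallCollar`; an instance of the general collar neighbourhood theorem, cf.
`Literature.Topology.FourManifolds.BoundaryData.nonempty_collar`). The shift to ball dimension `≥ 2` is necessary, see
`isSmoothEmbedding_closedBallCollarMap` and `isEmpty_collar_closedBallBoundaryData_zero`.
Given the named fact `isSmoothEmbedding_closedBallCollarMap n` (hypothesis `h`).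
Hirsch, *Differential Topology* (1976), Thm. 4.6.1. [folklore] -/
theorem nonempty_collar_closedBallBoundaryData [Fact (isSmoothEmbedding_sphereInclusion' (n + 1))]
    (h : isSmoothEmbedding_closedBallCollarMap n) :
    Nonempty (closedBallBoundaryData (n + 1)).Collar :=
  ⟨closedBallCollar n h⟩

/-- **No collar in ball dimension one.** The boundary datum `𝕊⁰ = ∂𝔻¹` has *no* collar in the
sense of `Literature.Topology.FourManifolds.BoundaryData.Collar` (model `(𝓡 0).prod (𝓡∂ 1)` on `𝕊⁰ × [0, 1]`): by
`Literature.Topology.FourManifolds.BoundaryData.Collar.apply_mem_interior` and `interior_closedBall` a collar `c` sends the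
corner `(x, ⊤)` to an interior point `c (x, ⊤)` of `𝔻¹`, i.e. `0 < ‖c (x, ⊤)‖ < 1`, whereas
Mathlib's immersion property at the model-boundary point `(x, ⊤)` (see the docstring of
`isSmoothEmbedding_closedBallCollarMap`) forces `c (x, ⊤)` to be sent to the model boundary
`{z | z 0 = 0}` by a chart of the maximal atlas of `𝔻¹`, which is impossible at an interior point
by (topological) invariance of the boundary in dimension one. The latter invariance is not in
Mathlib, so the proof is deferred. This records the `n = 0` obstruction behind the dimension
shift in `closedBallCollar`; it also shows that the general `Literature.Topology.FourManifolds.BoundaryData.nonempty_collar`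
of `Literature.Prelude.FourManL.Gluing` needs the hypothesis `n ≠ 0` (recorded there as a follow-up).
Standard (Hirsch, *Differential Topology* (1976), §1.4, invariance of the boundary). [cite: Hirsch1976, §1.4] -/
def isEmpty_collar_closedBallBoundaryData_zero [Fact (isSmoothEmbedding_sphereInclusion' 0)] :
    Prop :=
  IsEmpty (closedBallBoundaryData 0).Collar

/-! ### Discharge of `isSmoothEmbedding_sphereInclusion'` -/

/-- The linear isomorphism `ℝⁿ × ℝ ≃ ℝⁿ⁺¹`, `(w, t) ↦ (t, w₁, …, wₙ)` (prepend `t` as the `0`-th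
coordinate): the complement datum `equiv : (E × F) ≃L[ℝ] E'` (with `F = ℝ`) of Mathlib's
immersion property `Manifold.ImmersionAtProp` for the inclusion `𝕊ⁿ ↪ 𝔻ⁿ⁺¹` read in the charts
`stereographic' n (-x)` of `𝕊ⁿ` and `closedBallBoundaryChart x` of `𝔻ⁿ⁺¹`, where it is
`w ↦ (0, w)`. [folklore] -/
def sphereInclusionComplementEquiv : (𝔼 n × ℝ) ≃ₗ[ℝ] 𝔼 (n + 1) where
  toFun q := toLp 2 (Fin.cons q.2 (ofLp q.1) : Fin (n + 1) → ℝ)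
  invFun z := (toLp 2 fun i : Fin n => z i.succ, z 0)
  map_add' q q' := by
    ext i
    refine Fin.cases ?_ (fun j => ?_) i <;> simp
  map_smul' c q := by
    ext i
    refine Fin.cases ?_ (fun j => ?_) i <;> simp
  left_inv q := by
    ext i <;> simp
  right_inv z := by
    ext i
    refine Fin.cases ?_ (fun j => ?_) i <;> simp

/-- `sphereInclusionComplementEquiv n (w, t) = (t, w)` (definitional). [folklore] -/
@[simp]
theorem sphereInclusionComplementEquiv_apply (q : 𝔼 n × ℝ) :
    sphereInclusionComplementEquiv n q = toLp 2 (Fin.cons q.2 (ofLp q.1) : Fin (n + 1) → ℝ) :=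
  rfl

variable {n} in
/-- The radial projection fixes every point of the unit sphere. [folklore] -/
theorem radialProjection_coe_sphere (p s : 𝕊 n) : radialProjection p (s : 𝔼 (n + 1)) = s := by
  simpa using radialProjection_smul p one_pos s

/-- **Discharge of the named fact `isSmoothEmbedding_sphereInclusion'`**: the inclusion
`𝕊ⁿ ↪ 𝔻ⁿ⁺¹` is a smooth embedding (Mathlib's `Manifold.IsSmoothEmbedding (𝓡 n) (𝓡∂ (n + 1)) ∞`).
Real proof from the explicit atlas: it is a topological embedding
(`Topology.IsEmbedding.inclusion`), and an immersion with complement `ℝ`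
(`Manifold.IsImmersionOfComplement ℝ`) because at `x : 𝕊ⁿ`, in the domain chart
`stereographic' n (-x) = chartAt x` (target all of `ℝⁿ`) and the codomain chart
`closedBallBoundaryChart x`, the inclusion reads `w ↦ (1 - ‖σ⁻¹ w‖, σ (σ⁻¹ w)) = (0, w)
= sphereInclusionComplementEquiv n (w, 0)` on all of `ℝⁿ`. This is the model case of Lee,
*Introduction to Smooth Manifolds*, 2nd ed. (2013), Thm. 5.11 (if `M` is a smooth `n`-manifold
with boundary, then with the subspace topology `∂M` is a topological `(n-1)`-manifold without
boundary with a unique smooth structure making it a properly embedded hypersurface: the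
inclusion `∂M ↪ M` reads `(x¹,…,xⁿ⁻¹) ↦ (x¹,…,xⁿ⁻¹,0)` in boundary charts) combined with
Problem 1-11 (`𝔹̄ⁿ` is a smooth manifold with boundary `𝕊ⁿ⁻¹`); here Mathlib puts the boundary
coordinate first. [cite: Lee2013, Thm. 5.11 with Problem 1-11] -/
theorem isSmoothEmbedding_sphereInclusion'_holds : isSmoothEmbedding_sphereInclusion' n := by
  refine ⟨?_, Topology.IsEmbedding.inclusion _⟩
  refine Manifold.IsImmersionOfComplement.isImmersion (F := ℝ) fun x => ?_
  have hx : x ≠ -x := fun h => ne_neg_of_mem_unit_sphere ℝ x h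
  refine Manifold.IsImmersionAtOfComplement.mk_of_charts
    (sphereInclusionComplementEquiv n).toContinuousLinearEquiv
    (stereographic' n (-x)) (closedBallBoundaryChart x) ?_ ?_ ?_ ?_ ?_ ?_
  · -- `x ∈ (stereographic' n (-x)).source = {-x}ᶜ`
    simpa using ne_neg_of_mem_unit_sphere ℝ x
  · -- `x ∈ (closedBallBoundaryChart x).source`
    exact inclusion_mem_closedBallBoundaryChart_source n hx
  · -- the domain chart is `chartAt x`, hence in the maximal atlas of `𝕊ⁿ`
    exact IsManifold.chart_mem_maximalAtlas x
  · -- the codomain chart is in the atlas `instChartedSpaceClosedBall`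
    exact IsManifold.subset_maximalAtlas (mem_insert_of_mem _ (mem_range_self _))
  · -- the inclusion maps `{-x}ᶜ` into the source of the boundary chart at `x`
    intro y hy
    rw [stereographic'_source, mem_compl_singleton_iff] at hy
    exact inclusion_mem_closedBallBoundaryChart_source n hy
  · -- in these charts the inclusion is `w ↦ (0, w)`
    intro w _
    set s : 𝕊 n := (stereographic' n (-x)).symm w with hs
    have hw : stereographic' n (-x) s = w :=
      (stereographic' n (-x)).right_inv (by simp)
    rw [comp_apply, comp_apply, OpenPartialHomeomorph.extend_coe_symm, comp_apply,
      modelWithCornersSelf_coe_symm, id, ← hs, OpenPartialHomeomorph.extend_coe, comp_apply,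
      modelWithCornersEuclideanHalfSpace_apply, coe_closedBallBoundaryChart_apply, comp_apply,
      LinearEquiv.coe_toContinuousLinearEquiv', sphereInclusionComplementEquiv_apply]
    have h1 : ‖((Set.inclusion sphere_subset_closedBall s : 𝔻 (n + 1)) : 𝔼 (n + 1))‖ = 1 :=
      norm_eq_of_mem_sphere s
    have h2 : radialProjection x ((Set.inclusion sphere_subset_closedBall s : 𝔻 (n + 1)) :
        𝔼 (n + 1)) = s := radialProjection_coe_sphere x s
    rw [h1, h2, hw, sub_self]

/-- The `Fact` instance feeding the discharged named fact `isSmoothEmbedding_sphereInclusion'`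
to the consumers `closedBallBoundaryData`, `closedBallCollar`, … which take it as the instance
hypothesis `[Fact (isSmoothEmbedding_sphereInclusion' n)]`. [folklore] -/
instance fact_isSmoothEmbedding_sphereInclusion' : Fact (isSmoothEmbedding_sphereInclusion' n) :=
  ⟨isSmoothEmbedding_sphereInclusion'_holds n⟩

end Literature.Topology.FourManifolds
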